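import Mathlib
import Summits.Ventures.PercRepro2.TypedStarMulti

/-!
# THE MULTIGRAPH PIECES ARE THEOREMS, II: `N(H + e(1) + e'(1)) = pC + pT1`, AND THE CERTIFICATE
LIST SHRINKS TO FIVE (blind cell PercRepro2, p2 g2, 2026-08-25; sub-claim S1 (C))

`K₅` with two extra edges of type `1` on two pairs of a triangle: a copy with both open sees the path,
which connects exactly what the triangle does (`conn_path_iff_tri`, `mcount_path_tri₁/₂/₃`), so the
typed count of the multigraph is `pC S S' + pT1` (`typedCount_par2`), nonnegative by typer-1's
multigraph theorem (`pC_pT1_nonneg_path`, `pC_pT1_nonneg`).  With Part I: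

* **`StarCerts5 R b p₁ p₂ p₃`** — the five certified pieces of one `(marking, T)`: `pT1`, `pT2`, the
  three `pM`, one `pB + pM S*`;
* **`starPieces_of_certs5`** — the full certificate list `StarPieces` from them.

Own code; standard axioms.
-/

namespace Summit.Ventures.PercRepro2

open Hub

namespace K5

/-! ## Two extra edges on two pairs of a triangle: `pC + pT1` -/

section Two

variable {R : Type*} [Field R]

/-- The empty mask is a left unit for `mOr`. -/
lemma mOr_mNone_left (S : Fin 10 → Bool) : mOr mNone S = S := by
  funext j; simp [mOr, mNone]

/-- The empty mask is a right unit for `mOr`. -/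
lemma mOr_mNone_right (S : Fin 10 → Bool) : mOr S mNone = S := by
  funext j; simp [mOr, mNone]

/-- The pair mask is symmetric in its two vertices. -/
lemma pairMask_comm (a b : Fin 5) : pairMask a b = pairMask b a := by
  funext j
  rw [Bool.eq_iff_iff, pairMask_eq_true_iff, pairMask_eq_true_iff, Sym2.eq_swap]

/-- `mOr` is commutative. -/
lemma mOr_comm (S S' : Fin 10 → Bool) : mOr S S' = mOr S' S := by
  funext j; simp [mOr, Bool.or_comm]

/-- The extra mask of a star state on two extra edges. -/
lemma extMask_two (j₀ j₁ : Fin 10) (a a' : Bool) (x : Config (Fin 10 ⊕ Fin 2)) :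
    extMask (![j₀, j₁]) (Function.update (Function.update x (Sum.inr 1) a') (Sum.inr 0) a) =
      mOr (if a then edgeMask j₀ else mNone) (if a' then edgeMask j₁ else mNone) := by
  funext j
  unfold extMask edgeMask mNone mOr
  cases a <;> cases a' <;> simp [Fin.exists_fin_two]

/-- **`K₅` plus two extra edges of type `1` parallel to the pairs `j₀`, `j₁`**: the typed count of the
multigraph is the placement sum of the masked `K₅` counts. -/
theorem typedCount_par2 (F : Finset (Fin 10)) (τ : Fin 10 → ℕ) (j₀ j₁ : Fin 10) (o a₁ a₂ a₃ b : Fin 5) :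
    typedCount (insert (Sum.inr 0) (insert (Sum.inr 1) (inlF 2 F))) (fun _ => false) (parτ τ fun _ => 1)
        (CovForm.K3 (R := R) (endsPar ![j₀, j₁]) o a₁ a₂ a₃ b) =
      ∑ a : Bool, ∑ b' : Bool, ∑ c : Bool, if a.toNat + b'.toNat + c.toNat = 1 then
        (∑ a' : Bool, ∑ b'' : Bool, ∑ c' : Bool, if a'.toNat + b''.toNat + c'.toNat = 1 then
          mcount F (fun _ => false) τ (mOr (if a then edgeMask j₀ else mNone) (if a' then edgeMask j₁ else mNone))
            (mOr (if b' then edgeMask j₀ else mNone) (if b'' then edgeMask j₁ else mNone))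
            (mOr (if c then edgeMask j₀ else mNone) (if c' then edgeMask j₁ else mNone))
            (CovForm.K3 (R := R) ends5 o a₁ a₂ a₃ b)
        else 0) else 0 := by
  have h0 : (Sum.inr 0 : Fin 10 ⊕ Fin 2) ∈ insert (Sum.inr 0) (insert (Sum.inr 1) (inlF 2 F)) :=
    Finset.mem_insert_self _ _
  have h1 : (Sum.inr 1 : Fin 10 ⊕ Fin 2) ∈ insert (Sum.inr 0) (insert (Sum.inr 1) (inlF 2 F)) :=
    Finset.mem_insert_of_mem (Finset.mem_insert_self _ _)
  have h01 : (Sum.inr 0 : Fin 10 ⊕ Fin 2) ≠ Sum.inr 1 := by decide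
  have hF : ((insert (Sum.inr 0) (insert (Sum.inr 1) (inlF 2 F))).erase (Sum.inr 0)).erase (Sum.inr 1) =
      inlF 2 F := by
    rw [Finset.erase_insert, Finset.erase_insert (not_mem_inlF_inr F 1)]
    rw [Finset.mem_insert, not_or]
    exact ⟨h01, not_mem_inlF_inr F 0⟩
  rw [CovForm.TypedRed.typedCount_split2 _ h0 h1 h01, hF, Function.update_eq_self, Function.update_eq_self]
  refine Finset.sum_congr rfl fun a _ => Finset.sum_congr rfl fun b' _ =>
    Finset.sum_congr rfl fun c _ => ?_
  have ht0 : parτ τ (fun _ : Fin 2 => 1) (Sum.inr 0) = 1 := rfl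
  have ht1 : parτ τ (fun _ : Fin 2 => 1) (Sum.inr 1) = 1 := rfl
  rw [ht0]
  by_cases hA : a.toNat + b'.toNat + c.toNat = 1
  · rw [if_pos hA, if_pos hA]
    refine Finset.sum_congr rfl fun a' _ => Finset.sum_congr rfl fun b'' _ =>
      Finset.sum_congr rfl fun c' _ => ?_
    rw [ht1]
    by_cases hB : a'.toNat + b''.toNat + c'.toNat = 1
    · rw [if_pos hB, if_pos hB]
      unfold mcount
      rw [← typedCount_inlF_proj F τ (fun _ => 1)]
      refine typedCount_congr_closedOff _ _ _ _ fun x y w _ _ _ => ?_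
      rw [K3_par]
      simp only [extMask_two, projK5_update_inr]
    · rw [if_neg hB, if_neg hB]
  · rw [if_neg hA, if_neg hA]

end Two

/-! ## The path connects what the triangle connects -/

section Path

/-- The pairs of the triangle mask. -/
lemma triMask_eq_true_iff (p₁ p₂ p₃ : Fin 5) (j : Fin 10) :
    triMask p₁ p₂ p₃ j = true ↔ ends5 j = s(p₁, p₂) ∨ ends5 j = s(p₁, p₃) ∨ ends5 j = s(p₂, p₃) := by
  unfold triMask
  simp only [Bool.or_eq_true, pairMask_eq_true_iff]
  tauto

/-- The path on two pairs of the triangle is below the triangle. -/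
lemma orOn_path_le_tri {a b c p₁ p₂ p₃ : Fin 5}
    (hab : ∀ j, pairMask a b j = true → triMask p₁ p₂ p₃ j = true)
    (hbc : ∀ j, pairMask b c j = true → triMask p₁ p₂ p₃ j = true) (x : Fin 10 → Bool) :
    orOn (mOr (pairMask a b) (pairMask b c)) x ≤ orOn (triMask p₁ p₂ p₃) x := by
  intro j
  rw [Bool.le_iff_imp]
  intro h
  simp only [orOn, mOr, Bool.or_eq_true] at h ⊢
  rcases h with h | h | h
  · exact Or.inl h
  · exact Or.inr (hab j h)
  · exact Or.inr (hbc j h)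

/-- **The path `a–b–c` connects what the triangle on `{a, b, c}` connects**: for a triangle mask whose
pairs are `{a,b}`, `{b,c}`, `{a,c}` (in any order), connections through the triangle are connections
through the path. -/
theorem conn_path_iff_tri {a b c p₁ p₂ p₃ : Fin 5} (hab : a ≠ b) (hbc : b ≠ c)
    (htri : ∀ j, triMask p₁ p₂ p₃ j = true ↔ ends5 j = s(a, b) ∨ ends5 j = s(b, c) ∨ ends5 j = s(a, c))
    (x : Fin 10 → Bool) (u v : Fin 5) :
    Conn ends5 (orOn (mOr (pairMask a b) (pairMask b c)) x) u v ↔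
      Conn ends5 (orOn (triMask p₁ p₂ p₃) x) u v := by
  have hab' : ∀ j, pairMask a b j = true → triMask p₁ p₂ p₃ j = true := fun j h =>
    (htri j).2 (Or.inl ((pairMask_eq_true_iff _ _ _).1 h))
  have hbc' : ∀ j, pairMask b c j = true → triMask p₁ p₂ p₃ j = true := fun j h =>
    (htri j).2 (Or.inr (Or.inl ((pairMask_eq_true_iff _ _ _).1 h)))
  constructor
  · exact conn_mono (orOn_path_le_tri hab' hbc' x)
  · intro h
    set σ := orOn (mOr (pairMask a b) (pairMask b c)) x with hσ
    -- the path joins `a` to `c`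
    obtain ⟨jab, hjab⟩ := exists_edge5 a b hab
    obtain ⟨jbc, hjbc⟩ := exists_edge5 b c hbc
    have hσab : σ jab = true := by
      rw [hσ]; unfold orOn mOr
      simp [(pairMask_eq_true_iff a b jab).2 hjab]
    have hσbc : σ jbc = true := by
      rw [hσ]; unfold orOn mOr
      simp [(pairMask_eq_true_iff b c jbc).2 hjbc]
    have hac : Conn ends5 σ a c :=
      conn_trans (conn_of_openAdj ⟨jab, hσab, hjab⟩) (conn_of_openAdj ⟨jbc, hσbc, hjbc⟩)
    refine mem_of_conn_of_closed (S := {y | Conn ends5 σ u y}) (fun y hy y' hadj => ?_)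
      (conn_refl _ _ _) h
    obtain ⟨-, j, hj, hends⟩ := openGraph_adj.1 hadj
    simp only [orOn, Bool.or_eq_true] at hj
    have hopen : ∀ (h' : x j = true ∨ pairMask a b j = true ∨ pairMask b c j = true), σ j = true := by
      intro h'
      rw [hσ]
      simp only [orOn, mOr, Bool.or_eq_true]
      tauto
    rcases hj with hj | hj
    · exact conn_trans hy (conn_of_openAdj ⟨j, hopen (Or.inl hj), hends⟩)
    · rcases (htri j).1 hj with hj' | hj' | hj'
      · exact conn_trans hy (conn_of_openAdj ⟨j, hopen (Or.inr (Or.inl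
          ((pairMask_eq_true_iff a b j).2 hj'))), hends⟩)
      · exact conn_trans hy (conn_of_openAdj ⟨j, hopen (Or.inr (Or.inr
          ((pairMask_eq_true_iff b c j).2 hj'))), hends⟩)
      · -- the pair `{a, c}`: through `b`
        rw [hj'] at hends
        rcases Sym2.eq_iff.1 hends with ⟨rfl, rfl⟩ | ⟨rfl, rfl⟩
        · exact conn_trans hy hac
        · exact conn_trans hy (conn_symm hac)


/-- A masked count with the path mask in the first copy equals the one with the triangle mask. -/
lemma mcount_path_tri₁ {R : Type*} [Field R] {a b c p₁ p₂ p₃ : Fin 5} (hab : a ≠ b) (hbc : b ≠ c)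
    (htri : ∀ j, triMask p₁ p₂ p₃ j = true ↔ ends5 j = s(a, b) ∨ ends5 j = s(b, c) ∨ ends5 j = s(a, c))
    (F : Finset (Fin 10)) (τ : Fin 10 → ℕ) (S₂ S₃ : Fin 10 → Bool) (o a₁ a₂ a₃ b' : Fin 5) :
    mcount F (fun _ => false) τ (mOr (pairMask a b) (pairMask b c)) S₂ S₃
        (CovForm.K3 (R := R) ends5 o a₁ a₂ a₃ b') =
      mcount F (fun _ => false) τ (triMask p₁ p₂ p₃) S₂ S₃ (CovForm.K3 (R := R) ends5 o a₁ a₂ a₃ b') := by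
  unfold mcount
  refine typedCount_congr_closedOff _ _ _ _ fun x y w _ _ _ => ?_
  exact K3_congr_conn ends5 o a₁ a₂ a₃ b' (conn_path_iff_tri hab hbc htri x) (fun _ _ => Iff.rfl)
    (fun _ _ => Iff.rfl)

/-- The same in the second copy. -/
lemma mcount_path_tri₂ {R : Type*} [Field R] {a b c p₁ p₂ p₃ : Fin 5} (hab : a ≠ b) (hbc : b ≠ c)
    (htri : ∀ j, triMask p₁ p₂ p₃ j = true ↔ ends5 j = s(a, b) ∨ ends5 j = s(b, c) ∨ ends5 j = s(a, c))
    (F : Finset (Fin 10)) (τ : Fin 10 → ℕ) (S₁ S₃ : Fin 10 → Bool) (o a₁ a₂ a₃ b' : Fin 5) :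
    mcount F (fun _ => false) τ S₁ (mOr (pairMask a b) (pairMask b c)) S₃
        (CovForm.K3 (R := R) ends5 o a₁ a₂ a₃ b') =
      mcount F (fun _ => false) τ S₁ (triMask p₁ p₂ p₃) S₃ (CovForm.K3 (R := R) ends5 o a₁ a₂ a₃ b') := by
  unfold mcount
  refine typedCount_congr_closedOff _ _ _ _ fun x y w _ _ _ => ?_
  exact K3_congr_conn ends5 o a₁ a₂ a₃ b' (fun _ _ => Iff.rfl) (conn_path_iff_tri hab hbc htri y)
    (fun _ _ => Iff.rfl)

/-- The same in the third copy. -/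
lemma mcount_path_tri₃ {R : Type*} [Field R] {a b c p₁ p₂ p₃ : Fin 5} (hab : a ≠ b) (hbc : b ≠ c)
    (htri : ∀ j, triMask p₁ p₂ p₃ j = true ↔ ends5 j = s(a, b) ∨ ends5 j = s(b, c) ∨ ends5 j = s(a, c))
    (F : Finset (Fin 10)) (τ : Fin 10 → ℕ) (S₁ S₂ : Fin 10 → Bool) (o a₁ a₂ a₃ b' : Fin 5) :
    mcount F (fun _ => false) τ S₁ S₂ (mOr (pairMask a b) (pairMask b c))
        (CovForm.K3 (R := R) ends5 o a₁ a₂ a₃ b') =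
      mcount F (fun _ => false) τ S₁ S₂ (triMask p₁ p₂ p₃) (CovForm.K3 (R := R) ends5 o a₁ a₂ a₃ b') := by
  unfold mcount
  refine typedCount_congr_closedOff _ _ _ _ fun x y w _ _ _ => ?_
  exact K3_congr_conn ends5 o a₁ a₂ a₃ b' (fun _ _ => Iff.rfl) (fun _ _ => Iff.rfl)
    (conn_path_iff_tri hab hbc htri w)

end Path

/-! ## `pC + pT1` is a theorem -/

section CT

variable {R : Type*} [Field R] [LinearOrder R] [IsStrictOrderedRing R]

/-- **`pC (path) + pT1` is the typed count of `K₅` plus the two path edges, hence nonnegative**, for a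
path `a–b–c` on a triangle `{p₁, p₂, p₃} = {a, b, c}` of marks. -/
theorem pC_pT1_nonneg_path (b : Fin 5) (hb : b = 4 ∨ b = 3 ∨ b = 0) (F : Finset (Fin 10))
    (hF : MarkPairs 0 1 2 3 b F) (τ : Fin 10 → ℕ) {x y z p₁ p₂ p₃ : Fin 5} (hxy : x ≠ y) (hyz : y ≠ z)
    (htri : ∀ j, triMask p₁ p₂ p₃ j = true ↔ ends5 j = s(x, y) ∨ ends5 j = s(y, z) ∨ ends5 j = s(x, z))
    (hx : x = 0 ∨ x = 1 ∨ x = 2 ∨ x = 3 ∨ x = b) (hy : y = 0 ∨ y = 1 ∨ y = 2 ∨ y = 3 ∨ y = b)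
    (hz : z = 0 ∨ z = 1 ∨ z = 2 ∨ z = 3 ∨ z = b) :
    0 ≤ pC F (fun _ => false) τ (CovForm.K3 (R := R) ends5 0 1 2 3 b) (pairMask x y) (pairMask y z) +
      pE F (fun _ => false) τ (CovForm.K3 (R := R) ends5 0 1 2 3 b) (triMask p₁ p₂ p₃) := by
  obtain ⟨j₀, hj₀⟩ := exists_edge5 x y hxy
  obtain ⟨j₁, hj₁⟩ := exists_edge5 y z hyz
  -- the multigraph count is the piece
  have hid : typedCount (insert (Sum.inr 0) (insert (Sum.inr 1) (inlF 2 F))) (fun _ => false)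
      (parτ τ fun _ => 1) (CovForm.K3 (R := R) (endsPar ![j₀, j₁]) 0 1 2 3 b) =
      pC F (fun _ => false) τ (CovForm.K3 (R := R) ends5 0 1 2 3 b) (pairMask x y) (pairMask y z) +
        pE F (fun _ => false) τ (CovForm.K3 (R := R) ends5 0 1 2 3 b) (triMask p₁ p₂ p₃) := by
    rw [typedCount_par2]
    simp only [Fintype.sum_bool, Bool.toNat_true, Bool.toNat_false, Nat.reduceEqDiff, if_true, if_false,
      add_zero, zero_add, Bool.false_eq_true, mOr_mNone_left, mOr_mNone_right,
      edgeMask_eq_pairMask hj₀, edgeMask_eq_pairMask hj₁, mcount_path_tri₁ hxy hyz htri,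
      mcount_path_tri₂ hxy hyz htri, mcount_path_tri₃ hxy hyz htri]
    unfold pC pE
    ring
  rw [← hid]
  obtain ⟨h12, h31, h32, h01, h02, hb1, hb2, h03⟩ := marks_distinct_of b hb
  refine typedCount_K3_nonneg_multi_loops _ h12 h31 h32 h01 h02 hb1 hb2 h03 _ _ fun e he v hv => ?_
  rcases Finset.mem_insert.1 he with rfl | he
  · have hv' : v ∈ ends5 j₀ := hv
    rw [hj₀] at hv'
    rcases Sym2.mem_iff.1 hv' with rfl | rfl
    · exact hx
    · exact hy
  rcases Finset.mem_insert.1 he with rfl | he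
  · have hv' : v ∈ ends5 j₁ := hv
    rw [hj₁] at hv'
    rcases Sym2.mem_iff.1 hv' with rfl | rfl
    · exact hy
    · exact hz
  · obtain ⟨j, hjF, rfl⟩ := Finset.mem_map.1 he
    exact hF j hjF v hv


/-- **`pC + pT1` at the three pairs-of-pairs of a triangle of distinct marks.** -/
theorem pC_pT1_nonneg (b : Fin 5) (hb : b = 4 ∨ b = 3 ∨ b = 0) (F : Finset (Fin 10))
    (hF : MarkPairs 0 1 2 3 b F) (τ : Fin 10 → ℕ) {p₁ p₂ p₃ : Fin 5} (h12 : p₁ ≠ p₂) (h13 : p₁ ≠ p₃)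
    (h23 : p₂ ≠ p₃) (hp₁ : p₁ = 0 ∨ p₁ = 1 ∨ p₁ = 2 ∨ p₁ = 3 ∨ p₁ = b)
    (hp₂ : p₂ = 0 ∨ p₂ = 1 ∨ p₂ = 2 ∨ p₂ = 3 ∨ p₂ = b) (hp₃ : p₃ = 0 ∨ p₃ = 1 ∨ p₃ = 2 ∨ p₃ = 3 ∨ p₃ = b)
    (S S' : Fin 10 → Bool)
    (hSS : (S = pairMask p₁ p₂ ∧ S' = pairMask p₁ p₃) ∨ (S = pairMask p₁ p₂ ∧ S' = pairMask p₂ p₃) ∨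
      (S = pairMask p₁ p₃ ∧ S' = pairMask p₂ p₃)) :
    0 ≤ pC F (fun _ => false) τ (CovForm.K3 (R := R) ends5 0 1 2 3 b) S S' +
      pE F (fun _ => false) τ (CovForm.K3 (R := R) ends5 0 1 2 3 b) (triMask p₁ p₂ p₃) := by
  have hsw : ∀ (j : Fin 10) (x y : Fin 5), ends5 j = s(x, y) ↔ ends5 j = s(y, x) := by
    intro j x y
    rw [Sym2.eq_swap]
  rcases hSS with ⟨hS, hS'⟩ | ⟨hS, hS'⟩ | ⟨hS, hS'⟩
  · -- the path `p₂–p₁–p₃`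
    have hS2 : S = pairMask p₂ p₁ := hS.trans (pairMask_comm p₁ p₂)
    rw [hS2, hS']
    refine pC_pT1_nonneg_path b hb F hF τ h12.symm h13 (fun j => ?_) hp₂ hp₁ hp₃
    rw [triMask_eq_true_iff, hsw j p₁ p₂]
  · -- the path `p₁–p₂–p₃`
    rw [hS, hS']
    refine pC_pT1_nonneg_path b hb F hF τ h12 h23 (fun j => ?_) hp₁ hp₂ hp₃
    rw [triMask_eq_true_iff]
    exact or_congr_right or_comm
  · -- the path `p₁–p₃–p₂`
    have hS2 : S' = pairMask p₃ p₂ := hS'.trans (pairMask_comm p₂ p₃)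
    rw [hS, hS2]
    refine pC_pT1_nonneg_path b hb F hF τ h13 h23.symm (fun j => ?_) hp₁ hp₃ hp₂
    rw [triMask_eq_true_iff, hsw j p₂ p₃]
    exact or_rotate

/-- **The five certified pieces** of one `(marking, T)`: what typer-1 certifies. -/
structure StarCerts5 (R : Type*) [Field R] [LinearOrder R] (b p₁ p₂ p₃ : Fin 5) : Prop where
  hT1 : ∀ F τ, MarkPairs 0 1 2 3 b F →
    0 ≤ pE F (fun _ => false) τ (CovForm.K3 (R := R) ends5 0 1 2 3 b) (triMask p₁ p₂ p₃)
  hT2 : ∀ F τ, MarkPairs 0 1 2 3 b F →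
    0 ≤ pE2 F (fun _ => false) τ (CovForm.K3 (R := R) ends5 0 1 2 3 b) (triMask p₁ p₂ p₃)
  hM : ∀ F τ, MarkPairs 0 1 2 3 b F → ∀ S, (S = pairMask p₁ p₂ ∨ S = pairMask p₁ p₃ ∨ S = pairMask p₂ p₃) →
    0 ≤ pM F (fun _ => false) τ (CovForm.K3 (R := R) ends5 0 1 2 3 b) (triMask p₁ p₂ p₃) S
  hTvT : ∃ S, (S = pairMask p₁ p₂ ∨ S = pairMask p₁ p₃ ∨ S = pairMask p₂ p₃) ∧
    ∀ F τ, MarkPairs 0 1 2 3 b F →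
      0 ≤ pB F (fun _ => false) τ (CovForm.K3 (R := R) ends5 0 1 2 3 b) (pairMask p₁ p₂)
          (pairMask p₁ p₃) (pairMask p₂ p₃) +
        pM F (fun _ => false) τ (CovForm.K3 (R := R) ends5 0 1 2 3 b) (triMask p₁ p₂ p₃) S

/-- **The full certificate list from the five certified pieces** — the multigraph pieces are theorems. -/
theorem starPieces_of_certs5 (b : Fin 5) (hb : b = 4 ∨ b = 3 ∨ b = 0) {p₁ p₂ p₃ : Fin 5}
    (h12 : p₁ ≠ p₂) (h13 : p₁ ≠ p₃) (h23 : p₂ ≠ p₃) (hp₁ : p₁ = 0 ∨ p₁ = 1 ∨ p₁ = 2 ∨ p₁ = 3 ∨ p₁ = b)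
    (hp₂ : p₂ = 0 ∨ p₂ = 1 ∨ p₂ = 2 ∨ p₂ = 3 ∨ p₂ = b) (hp₃ : p₃ = 0 ∨ p₃ = 1 ∨ p₃ = 2 ∨ p₃ = 3 ∨ p₃ = b)
    (h : StarCerts5 R b p₁ p₂ p₃) : StarPieces R 0 1 2 3 b p₁ p₂ p₃ where
  hN F τ hF := pN_nonneg b hb F hF τ
  hE F τ hF S hS := by
    rcases hS with rfl | rfl | rfl
    · exact pE_nonneg b hb F hF τ h12 hp₁ hp₂
    · exact pE_nonneg b hb F hF τ h13 hp₁ hp₃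
    · exact pE_nonneg b hb F hF τ h23 hp₂ hp₃
  hE2 F τ hF S hS := by
    rcases hS with rfl | rfl | rfl
    · exact pE2_nonneg b hb F hF τ h12 hp₁ hp₂
    · exact pE2_nonneg b hb F hF τ h13 hp₁ hp₃
    · exact pE2_nonneg b hb F hF τ h23 hp₂ hp₃
  hT1 := h.hT1
  hT2 := h.hT2
  hM := h.hM
  hC F τ hF S S' hSS := pC_pT1_nonneg b hb F hF τ h12 h13 h23 hp₁ hp₂ hp₃ S S' hSS
  hTvT := h.hTvT

end CT

end K5

end Summit.Ventures.PercRepro2
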